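import Summits.Parity.GeneralizedHardyLittlewood.Theorems.Dhl42CertIneq
import Summits.Parity.GeneralizedHardyLittlewood.Theorems.Dhl42IntegrabilityCover
import Summits.Parity.GeneralizedHardyLittlewood.Theorems.Dhl42Cover

/-!
# DHL[42,2] certificate — Lemma 6.2 and the measure half of Corollary 6.4 at the §7 instance

§6: permutation invariance of `F₀`, `OmegaF`, `Esets` (so every marginal of `F₀` is `F0marg`:
`margAt_F0_eq_F0marg`), `measurableSet_OmegaF`, the instance
`certSetup42 bf : CertSetup 41 Member _` for an arbitrary bin family `bf` (all 17 hypotheses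
discharged by theorems of `Dhl42Integrability*`, `Dhl42Cover`), the identifications `JK = JKval`,
`LG = LGval`, `A = Aval`, `B = Bval`, `cross = totalCross bf`, **`certificateInequality`**
(`42·JKval − 42·LGval − 2·totalCross bf ≤ varLHS (F₀1_Ω) (fun _ ↦ F0marg·1_{Ω'})`),
`integral_F_sq_le_Ival`, **`varhyp_of_certificate`** (the hypotheses `42 L_G ≤ L'`, `2Σ√(AB) ≤ X'`,
`(2/θ)I < 42J^K − L' − X'` give (4.3)), the proviso `⟨F,F⟩ > 0` (`integral_F_sq_pos`: `F₀` is
continuous near `0` with `F₀(0) > 0`), and `thmA_hypotheses_of_certificate` (both analytic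
hypotheses of Theorem 4.3 at once).

Origin: `Dhl42/CertificateInequality.lean` of the DHL[42,2] certificate package (pub-dhl42 bundle,
archive blob `18cce9e3`; sha256[:16] of the file `ba7c9b2361ca6afe`; paper snapshot =
`paper/main.tex` v1), lines :974–:1255; statements and proofs unchanged except: namespace
`TpY4Dhl42` → `Summit.Parity.GeneralizedHardyLittlewood.Theorems.Dhl42`, the package's
`simplexSet n B` replaced by the tree's definitionally equal
`Literature.NumberTheory.Sieve.scaledSimplex n B` (also inside declaration names), docstrings added
where missing (the docstrings of `certSetup42`, `varhyp_of_certificate` re-worded for the tree: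
package-internal pointers removed, mathematics unchanged), `#print axioms` lines dropped.
Package-internal references in the verbatim docstrings (`Dhl42/….lean`, `Assumed.…`, `row 9…`,
`gen n`, `inputs/COMPARE.md`) refer to that package (paper Appendix B).

Declarations (30): `F0_comp_perm`, `bigU_comp_perm`, `OmegaF_comp_perm`, `Esets_comp_perm`,
`margAt_F0_eq_F0marg`, `measurableSet_OmegaF`, `memberGrade`, `memberTau0_eq`,
`lt_sum_of_mem_Esets`, `Esets_subset_scaledSimplex`, `certSetup42`, `certSetup42_JK`,
`certSetup42_LG`, `certSetup42_F`, `certSetup42_G`, `certSetup42_A`, `certSetup42_B`,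
`certSetup42_cross`, `certificateInequality`, `integral_F_sq_le_Ival`, `varhyp_of_certificate`,
`F0cont`, `continuous_F0cont`, `F0_eq_F0cont`, `Kc_pos`, `F0cont_zero`, `mem_OmegaF_of_sum_le`,
`integrable_F_sq`, `integral_F_sq_pos`, `thmA_hypotheses_of_certificate`.
-/

open MeasureTheory Set Filter
open Literature.NumberTheory.Sieve (scaledSimplex measurableSet_scaledSimplex)

namespace Summit.Parity.GeneralizedHardyLittlewood.Theorems.Dhl42

noncomputable section

/-! ### §6. The instance of Section 7 (`k = 42`): `F₀`, `(Ω, Ω') = (OmegaF, OmegaG)`, the 126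
cover members `Esets` with depths `e = ε_{2,g}`, and the bins of an arbitrary bin family `bf` -/

section Instance

/-! #### Permutation invariance of the Section-7 objects -/

/-- The trial function `F₀` of Section 7.2 is symmetric: `F₀ (t ∘ σ) = F₀ t` for every permutation
`σ` of the 42 coordinates. -/
theorem F0_comp_perm (σ : Equiv.Perm (Fin 42)) (t : Fin 42 → ℝ) : F0 (t ∘ ⇑σ) = F0 t := by
  have hs : ∑ j, t (σ j) = ∑ j, t j := Equiv.sum_comp σ t
  have hp : ∏ j, gfun (t (σ j)) = ∏ j, gfun (t j) := Equiv.prod_comp σ (fun j => gfun (t j))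
  have hR : Rmark (t ∘ ⇑σ) = Rmark t := Equiv.sum_comp σ (fun j => hfun (t j) / gfun (t j))
  unfold F0
  by_cases ht : t ∈ scaledSimplex 42 Sc
  · simp only [indicator_of_mem ht, indicator_of_mem ((comp_perm_mem_scaledSimplex_iff σ t Sc).2 ht),
      Function.comp_apply, hs, hp, hR]
  · rw [indicator_of_notMem ht,
      indicator_of_notMem fun h => ht ((comp_perm_mem_scaledSimplex_iff σ t Sc).1 h)]

/-- `U_{t∘σ}(u) = U_t(u)`: `U_t` is a symmetric function of `t`. -/
theorem bigU_comp_perm {k : ℕ} (σ : Equiv.Perm (Fin k)) (t : Fin k → ℝ) (u : ℝ) :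
    bigU (t ∘ ⇑σ) u = bigU t u :=
  Equiv.sum_comp σ (fun j => if u ≤ t j then t j else 0)

/-- `Ω = OmegaF` is a symmetric set (defined through `Σ t` and `U_t`). -/
theorem OmegaF_comp_perm (σ : Equiv.Perm (Fin 42)) (t : Fin 42 → ℝ) :
    t ∘ ⇑σ ∈ OmegaF ↔ t ∈ OmegaF := by
  have hs : ∑ j, t (σ j) = ∑ j, t j := Equiv.sum_comp σ t
  simp only [OmegaF, mem_setOf_eq, comp_perm_mem_scaledSimplex_iff, Function.comp_apply, hs,
    bigU_comp_perm]

/-- Every cover member `Esets m` is a symmetric set (defined through `Σ t` and `U_t`). -/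
theorem Esets_comp_perm (m : Member) (σ : Equiv.Perm (Fin 42)) (t : Fin 42 → ℝ) :
    t ∘ ⇑σ ∈ Esets m ↔ t ∈ Esets m := by
  have hs : ∑ j, t (σ j) = ∑ j, t j := Equiv.sum_comp σ t
  rcases m with ⟨g, l⟩ | l <;>
    simp only [Esets, mem_setOf_eq, comp_perm_mem_scaledSimplex_iff, Function.comp_apply, hs,
      bigU_comp_perm]

/-- By the symmetry of `F₀`, EVERY marginal `(F₀)_m` is the function `F0marg = (F₀)₁` (the
paper-side fact recorded in the docstring of `F0marg`, now a theorem). -/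
theorem margAt_F0_eq_F0marg (m : Fin 42) : margAt m F0 = F0marg :=
  margAt_eq_marg_of_symm F0_comp_perm m

/-- `Ω = OmegaF` is Lebesgue measurable: `S·R₄₂` cut by finitely many constraints on the coordinate
sum and on the measurable functions `t ↦ U_t(u_l)`. -/
theorem measurableSet_OmegaF : MeasurableSet OmegaF := by
  have h : ∀ g : Fin 3, MeasurableSet {t : Fin 42 → ℝ |
      (∑ j, t j) ≤ Sc - eps2 g ∨ ∀ l : Fin 54, bigU t (uvec l) ≤ tauFband g l} := fun g => by
    have h2 : MeasurableSet (⋂ l : Fin 54, {t : Fin 42 → ℝ | bigU t (uvec l) ≤ tauFband g l}) :=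
      MeasurableSet.iInter fun l => measurableSet_le (measurable_bigU _) measurable_const
    have e : {t : Fin 42 → ℝ | ∀ l : Fin 54, bigU t (uvec l) ≤ tauFband g l} =
        ⋂ l : Fin 54, {t : Fin 42 → ℝ | bigU t (uvec l) ≤ tauFband g l} := by
      ext t; simp
    have h3 : MeasurableSet {t : Fin 42 → ℝ | ∀ l : Fin 54, bigU t (uvec l) ≤ tauFband g l} := by
      rw [e]; exact h2
    exact (measurableSet_le (measurable_sum_coord 42) measurable_const).union h3
  have : OmegaF = scaledSimplex 42 Sc ∩ ⋂ g, {t : Fin 42 → ℝ |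
      (∑ j, t j) ≤ Sc - eps2 g ∨ ∀ l : Fin 54, bigU t (uvec l) ≤ tauFband g l} := by
    ext t; simp [OmegaF]
  rw [this]
  exact (measurableSet_scaledSimplex 42 Sc).inter (MeasurableSet.iInter h)

/-! #### The cover members: grade, depth, and the instance of `CertSetup` -/

/-- The grade carried by a cover member: band members `inl (g, l)` their band `g`, the layer
members `inr l` grade A (`= 0`). -/
def memberGrade : Member → Fin 3
  | .inl (g, _) => g
  | .inr _ => 0

/-- The bin base of a member is `τ_{0,g} = S − ε_{2,g} − K` with `g` the member's grade
(`memberGrade`). -/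
theorem memberTau0_eq (m : Member) : memberTau0 m = Sc - eps2 (memberGrade m) - Kc := by
  rcases m with ⟨g, l⟩ | l <;> rfl

/-- `E_m ⊆ {Σt > S − e_m}` with `e_m = ε_{2, grade(m)}` (the hypothesis `E_j ⊆ {Σt > S − e_j}` of
Lemma 6.2). -/
theorem lt_sum_of_mem_Esets (m : Member) (t : Fin 42 → ℝ) (ht : t ∈ Esets m) :
    Sc - eps2 (memberGrade m) < ∑ j, t j := by
  rcases m with ⟨g, l⟩ | l
  · have h := ht.2.1.2
    show Sc - eps2 g < ∑ j, t j
    linarith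
  · exact ht.2.1

/-- Every cover member lies in `S·R₄₂`. -/
theorem Esets_subset_scaledSimplex (m : Member) : Esets m ⊆ scaledSimplex 42 Sc := by
  rcases m with ⟨g, l⟩ | l <;> exact fun _ ht => ht.1

/-- The data of Lemma 6.2 at the Section-7 instance, for a choice `bf` of a bin family on each of
the 126 members: `S = Sc`, `K = Kc`, `F₀ = F0`, `Ω = OmegaF`, `Ω' = OmegaG`, `E = Esets`,
`e_m = ε_{2,grade(m)}` (so `S − e_m − K = memberTau0 m`), `β_{m i} = binSet (bf m) i`. Each of the
17 hypotheses is discharged by a theorem: the covers `Esets_cover`, `binSets_cover` (`Dhl42Cover`),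
measurability and boundedness (`Dhl42Integrability`, `Dhl42IntegrabilityCover`), and the permutation
invariances above. -/
def certSetup42 (bf : ∀ m : Member, MemberBins (memberTau0 m)) :
    CertSetup 41 Member (fun m => Fin (bf m).n) where
  S := Sc
  K := Kc
  F0 := F0
  Ω := OmegaF
  Ω' := OmegaG
  E := Esets
  e := fun m => eps2 (memberGrade m)
  β := fun m i => binSet (bf m) i
  measurable_F0 := measurable_F0
  exists_bound_F0 := by
    obtain ⟨C, -, hC⟩ := exists_bound_F0
    exact ⟨C, hC⟩
  F0_eq_zero := fun _ ht => F0_eq_zero_of_not_mem ht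
  F0_symm := F0_comp_perm
  measurableSet_Ω := measurableSet_OmegaF
  Ω_subset := fun _ ht => ht.1
  Ω_symm := OmegaF_comp_perm
  measurableSet_Ω' := measurableSet_OmegaG
  Ω'_subset := OmegaG_subset
  measurableSet_E := measurableSet_Esets
  E_subset := Esets_subset_scaledSimplex
  E_symm := Esets_comp_perm
  lt_sum_of_mem_E := lt_sum_of_mem_Esets
  cover := Esets_cover
  measurableSet_β := fun m i => measurableSet_binSet (bf m) i
  β_cover := fun m s hs hs' => binSets_cover (bf m) s (by rw [memberTau0_eq]; exact hs.le) hs'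

variable (bf : ∀ m : Member, MemberBins (memberTau0 m))

/-- The `J^K` of the instance is `JKval` (definitional). -/
theorem certSetup42_JK : (certSetup42 bf).JK = JKval := rfl

/-- The `L_G` of the instance is `LGval` (definitional). -/
theorem certSetup42_LG : (certSetup42 bf).LG = LGval := rfl

/-- The `F` of the instance is `F₀ 1_Ω = OmegaF.indicator F0` (definitional). -/
theorem certSetup42_F : (certSetup42 bf).F = OmegaF.indicator F0 := rfl

/-- The `G` of the instance is `(F₀)₁ 1_{Ω'} = OmegaG.indicator F0marg` (definitional). -/
theorem certSetup42_G : (certSetup42 bf).G = OmegaG.indicator F0marg := rfl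

/-- The `A_{mβ}` of the instance is `Aval m β` (`N_β` as a real number, `Nbin_real_eq`). -/
theorem certSetup42_A (m : Member) (β : Set ℝ) : (certSetup42 bf).A m β = Aval m β := by
  unfold CertSetup.A Aval
  congr 1
  funext t
  rw [Nbin_real_eq]
  rfl

/-- The `B_{mβ}` of the instance is `Bval m β` (`41 + 1 = 42`). -/
theorem certSetup42_B (m : Member) (β : Set ℝ) : (certSetup42 bf).B m β = Bval m β := by
  have h : (certSetup42 bf).b m β = ∫ t' in OmegaG, F0marg t' ^ 2 * lenJI m β t' := rfl
  unfold CertSetup.B Bval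
  rw [h]
  norm_num

/-- The cross term of the instance, for the bin family `bf`, is `totalCross bf` (eq. (15)). -/
theorem certSetup42_cross : (certSetup42 bf).cross = totalCross bf := by
  unfold CertSetup.cross totalCross crossOf
  refine Finset.sum_congr rfl fun m _ => Finset.sum_congr rfl fun i _ => ?_
  rw [certSetup42_A, certSetup42_B]
  rfl

/-- **Lemma 6.2 at the Section-7 instance** (paper `lem:cert`, eq. (6.2), with `k = 42`,
`F = F₀1_Ω`, `G_m = (F₀)_m 1_{Ω'} = F0marg · 1_{Ω'}` for every `m`, and the `Ω'`-restricted
`B`): for every choice of bin families,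
`Σ_{m=1}^{42} (2⟨F_m, G_m⟩ − ⟨G_m, G_m⟩) ≥ 42 J^K(F₀) − 42 L_G − 2 Σ_j Σ_i √(A_{ji} B_{ji})`,
the right side being exactly the quantity `42 * JKval - 42 * LGval - 2 * totalCross bf` of the
refereed leg. -/
theorem certificateInequality :
    42 * JKval - 42 * LGval - 2 * totalCross bf ≤
      varLHS (OmegaF.indicator F0) (fun _ => OmegaG.indicator F0marg) := by
  have h := (certSetup42 bf).certIneq
  have e : ((41 : ℕ) : ℝ) + 1 = 42 := by norm_num
  rw [e, certSetup42_JK, certSetup42_LG, certSetup42_cross, certSetup42_F, certSetup42_G] at h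
  exact h

/-- `⟨F, F⟩ ≤ I(F₀)` for `F = F₀ 1_Ω` (first assertion of Lemma 6.2). -/
theorem integral_F_sq_le_Ival : ∫ t, OmegaF.indicator F0 t ^ 2 ≤ Ival := by
  have hT : Tame (scaledSimplex 42 Sc) F0 := by
    obtain ⟨C, hC0, hC⟩ := exists_bound_F0
    exact ⟨measurable_F0, ⟨C, hC0, hC⟩, fun _ ht => F0_eq_zero_of_not_mem ht⟩
  unfold Ival
  refine integral_mono (((hT.indicator measurableSet_OmegaF).sq).integrable volume_simplex42_ne_top)
    integrable_F0_sq fun t => ?_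
  by_cases ht : t ∈ OmegaF
  · simp [indicator_of_mem ht]
  · simp [indicator_of_notMem ht, sq_nonneg]

/-- **Corollary 6.4, measure-theoretic half, at the Section-7 instance.** The certificate inequality
in the form assumed by `Corollary64Instance` (`Dhl42Theorem43`) — upper bounds `L' ≥ 42 L_G`,
`X' ≥ 2 Σ√(AB)` and `(2/θ) I(F₀) < 42 J^K(F₀) − L' − X'` — implies the variational hypothesis (4.3)
of Theorem 4.3 for `F = F₀ 1_Ω`, `G_m = (F₀)_m 1_{Ω'}`:
`Σ_m (2⟨F_m, G_m⟩ − ⟨G_m, G_m⟩) > (2/θ) ⟨F, F⟩`. -/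
theorem varhyp_of_certificate {L' X' : ℝ} (hL : 42 * LGval ≤ L') (hX : 2 * totalCross bf ≤ X')
    (hcert : 2 / theta * Ival < 42 * JKval - L' - X') :
    2 / theta * ∫ t, OmegaF.indicator F0 t ^ 2 <
      varLHS (OmegaF.indicator F0) (fun _ => OmegaG.indicator F0marg) := by
  have h1 := certificateInequality bf
  have hθ : 0 < 2 / theta := by rw [theta_eq]; norm_num
  have h3 : 2 / theta * ∫ t, OmegaF.indicator F0 t ^ 2 ≤ 2 / theta * Ival :=
    mul_le_mul_of_nonneg_left integral_F_sq_le_Ival hθ.le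
  linarith

/-! #### Positivity `⟨F, F⟩ > 0` (the proviso of Corollary 6.4: "`F₀` does not vanish a.e. on
`{Σt ≤ S − max_g ε_{2,g}} ⊆ Ω`"; here from continuity and `F₀(0) > 0`) -/

/-- The continuous function which agrees with `F0` on `{t ∈ S·R₄₂ : Σt ≤ K}` (no cut-offs). -/
def F0cont (t : Fin 42 → ℝ) : ℝ :=
  (∏ j, gfun (t j)) * (PhiPoly (∑ j, t j) + PhiCut (∑ j, t j) + chiPoly (∑ j, t j) * Rmark t)

/-- `F0cont` is continuous. -/
theorem continuous_F0cont : Continuous F0cont := by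
  unfold F0cont
  have hs : Continuous fun t : Fin 42 → ℝ => ∑ j, t j :=
    continuous_finsetSum _ fun j _ => continuous_apply j
  exact continuous_prod_gfun.mul (((continuous_PhiPoly.comp hs).add (continuous_PhiCut.comp hs)).add
    ((continuous_chiPoly.comp hs).mul continuous_Rmark))

/-- On `S·R₄₂ ∩ {Σ t ≤ K}` the trial function `F₀` agrees with the continuous function `F0cont`
(both cut-offs are inactive there). -/
theorem F0_eq_F0cont {t : Fin 42 → ℝ} (ht : t ∈ scaledSimplex 42 Sc) (hK : ∑ j, t j ≤ Kc) :
    F0 t = F0cont t := by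
  rw [F0_eq_indicator, indicator_of_mem ht]
  unfold F0core F0cont
  rw [Phi_eq, chi_eq, if_pos hK, if_pos hK]

/-- `0 < K` (`K = 191/200`). -/
theorem Kc_pos : 0 < Kc := by unfold Kc eps; norm_num

/-- `F0cont 0 = F₀ 0`. -/
theorem F0cont_zero : F0cont 0 = F0 0 :=
  (F0_eq_F0cont OmegaF_nonempty.1 (by simp [Kc_pos.le])).symm

/-- Small non-negative points lie in `Ω` (below every layer). -/
theorem mem_OmegaF_of_sum_le {t : Fin 42 → ℝ} (h0 : ∀ j, 0 ≤ t j) (hs : ∑ j, t j ≤ Sc - eps2 0) :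
    t ∈ OmegaF := by
  have hε : ∀ g : Fin 3, eps2 g ≤ eps2 0 := by
    intro g
    fin_cases g
    · exact le_rfl
    · exact eps2_anti.2.le
    · exact (eps2_anti.1.trans eps2_anti.2).le
  have hε0 : 0 ≤ eps2 0 := (eps2C_pos.trans (eps2_anti.1.trans eps2_anti.2)).le
  exact ⟨⟨h0, by linarith⟩, fun g => Or.inl (by linarith [hε g])⟩

/-- `(F₀ 1_Ω)²` is integrable. -/
theorem integrable_F_sq : Integrable fun t => OmegaF.indicator F0 t ^ 2 := by
  have hT : Tame (scaledSimplex 42 Sc) F0 := by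
    obtain ⟨C, hC0, hC⟩ := exists_bound_F0
    exact ⟨measurable_F0, ⟨C, hC0, hC⟩, fun _ ht => F0_eq_zero_of_not_mem ht⟩
  exact ((hT.indicator measurableSet_OmegaF).sq).integrable volume_simplex42_ne_top

/-- `⟨F, F⟩ > 0` for `F = F₀ 1_Ω`: `F₀` is continuous near `0` with `F₀(0) > 0` (`F0_zero_pos`), and a
small cube at the origin lies inside `Ω`. -/
theorem integral_F_sq_pos : 0 < ∫ t, OmegaF.indicator F0 t ^ 2 := by
  have hF0 := F0_zero_pos
  obtain ⟨δ, hδ, hδF⟩ := Metric.continuous_iff.1 continuous_F0cont 0 (F0 0 / 2) (half_pos hF0)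
  set r : ℝ := min (δ / 2) (1 / 100) with hr
  have hr0 : 0 < r := lt_min (half_pos hδ) (by norm_num)
  have hrδ : r < δ := lt_of_le_of_lt (min_le_left _ _) (half_lt_self hδ)
  have hr1 : r ≤ 1 / 100 := min_le_right _ _
  set Q : Set (Fin 42 → ℝ) := Icc 0 (fun _ => r) with hQ
  have hε0 : eps2 0 = 427790849 / 5211420000 := eps2A_eq
  have hQval : ∀ t ∈ Q, (F0 0 / 2) ^ 2 ≤ OmegaF.indicator F0 t ^ 2 := by
    intro t ht
    have h0 : ∀ j, 0 ≤ t j := fun j => ht.1 j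
    have h1 : ∀ j, t j ≤ r := fun j => ht.2 j
    have hsum : ∑ j, t j ≤ 42 * r := le_trans (Finset.sum_le_sum fun j _ => h1 j) (by simp)
    have hsimp : t ∈ scaledSimplex 42 Sc := ⟨h0, by unfold Sc eps; linarith⟩
    have hΩ : t ∈ OmegaF := mem_OmegaF_of_sum_le h0 (by rw [hε0]; unfold Sc eps; linarith)
    have hK : ∑ j, t j ≤ Kc := by unfold Kc eps; linarith
    have hdist : dist t 0 < δ := by
      rw [dist_pi_lt_iff hδ]
      intro j
      rw [Real.dist_eq, Pi.zero_apply, sub_zero, abs_of_nonneg (h0 j)]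
      exact lt_of_le_of_lt (h1 j) hrδ
    have hclose := hδF t hdist
    rw [Real.dist_eq, F0cont_zero, ← F0_eq_F0cont hsimp hK, abs_lt] at hclose
    rw [indicator_of_mem hΩ]
    have hge : F0 0 / 2 ≤ F0 t := by linarith [hclose.1]
    exact pow_le_pow_left₀ (by linarith) hge 2
  have hQvol : volume.real Q = r ^ 42 := by
    rw [measureReal_def, hQ, Real.volume_Icc_pi_toReal (a := 0) (b := fun _ => r) fun _ => hr0.le]
    simp
  have hQfin : volume Q ≠ ⊤ := by
    rw [hQ]
    exact isCompact_Icc.measure_lt_top.ne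
  calc (0 : ℝ) < (F0 0 / 2) ^ 2 * r ^ 42 := by positivity
    _ = ∫ _ in Q, (F0 0 / 2) ^ 2 := by rw [setIntegral_const, hQvol, smul_eq_mul, mul_comm]
    _ ≤ ∫ t in Q, OmegaF.indicator F0 t ^ 2 :=
        setIntegral_mono_on (integrableOn_const hQfin) integrable_F_sq.integrableOn measurableSet_Icc
          hQval
    _ ≤ ∫ t, OmegaF.indicator F0 t ^ 2 :=
        setIntegral_le_integral integrable_F_sq (ae_of_all _ fun t => sq_nonneg _)

/-- The two analytic hypotheses of Theorem 4.3 (`thm:A`) about `(F, G_m)` — `⟨F, F⟩ > 0` and the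
variational hypothesis (4.3) — hold for `F = F₀1_Ω`, `G_m = (F₀)_m 1_{Ω'}` as soon as the certificate
inequality of `Corollary64Instance` does. -/
theorem thmA_hypotheses_of_certificate {L' X' : ℝ} (hL : 42 * LGval ≤ L')
    (hX : 2 * totalCross bf ≤ X') (hcert : 2 / theta * Ival < 42 * JKval - L' - X') :
    0 < ∫ t, OmegaF.indicator F0 t ^ 2 ∧
      2 / theta * ∫ t, OmegaF.indicator F0 t ^ 2 <
        varLHS (OmegaF.indicator F0) (fun _ => OmegaG.indicator F0marg) :=
  ⟨integral_F_sq_pos, varhyp_of_certificate bf hL hX hcert⟩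

end Instance

end

end Summit.Parity.GeneralizedHardyLittlewood.Theorems.Dhl42
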